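import Summits.ABC.ABC.Theorems.TowerFourSubLiouville.Negative.PadeFewnomial

/-!
# `TowerFourSubLiouville` (stmt-ABC-1649): the Padé weights of the fourth root — signs, integrality, and the value bound of the
general step (`|(N+1)P⁴ − NQ⁴| ≤ C_z·N^{2z}` with POSITIVE INTEGER step polynomials, for every `z`)

Negative-side module of the standing disprover (cycle 17, refuter-cdisprove-stmt-ABC-1649-g17-0, 2026-08-17), part 2 of the general-`z` programme
started in `Negative.PadeFewnomial` (p162752: for every `z` the Lagrange weights `c_e = 1/∏_{e'∈S_z∖{e}}(e − e')` on `S_z = {4i+1} ∪ {4i}` give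
`(X − 1)^{2z+1} ∣ X·p_z⁴ − q_z⁴`, `p_z = Σ c_{4i+1}X^i`, `q_z = −Σ c_{4i}X^i`).  This file turns that into the arithmetic input of a step family:

* SIGNS (`padeWeightDen_odd_pos`, `padeWeightDen_even_neg`): `c_{4i+1} > 0 > c_{4i}` for `i ≤ z` — after splitting `S_z ∖ {e}` by residues mod `4`
  the factors pair up as `4d·(4d ± 1) > 0` (`d = i − i' ≠ 0`), with one unpaired factor `+1` resp. `−1`;
* INTEGRALITY (`padeWeight_integral`): `M_z·c_e ∈ ℤ` for `M_z = |∏_{e∈S_z}∏_{e'≠e}(e − e')|`;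
* VALUE BOUND (`padeValue_bound`, from ANY divisibility `(X−1)^{2z+1} ∣ Xp⁴ − q⁴`, `deg p, q ≤ z`): the homogenised values
  `P(N) = Σ aᵢ(N+1)ⁱN^{z−i}`, `Q(N) = Σ bᵢ(N+1)ⁱN^{z−i}` satisfy `|(N+1)P(N)⁴ − N·Q(N)⁴| ≤ C·N^{2z}` (`N ≥ 1`; evaluate at `x = (N+1)/N`,
  `(x − 1)^{2z+1} = N^{−2z−1}`, and bound the cofactor on `[1, 2]`);
* PACKAGED (`exists_padeStepData`): **for every `z` there are integers `a₀, …, a_z > 0`, `b₀, …, b_z > 0` and `C` with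
  `|(N+1)·(Σ aᵢ(N+1)ⁱN^{z−i})⁴ − N·(Σ bᵢ(N+1)ⁱN^{z−i})⁴| ≤ C·N^{2z}` for all `N ≥ 1`** — the `z`-uniform form of `padeStep₁/₂/₃_identity`
  (`z ≤ 3`: `(a, b) ∝ ((5,3), (3,5))`, `((15,42,7), (7,42,15))`, `((195,1287,1001,77), (77,1001,1287,195))`).
Consumed by `Negative.CriticalEdge` (the lobes `{θ > 4/(2z+1), φ > 8z/(4z+1)}` for every `z`, hence `UBQ₂(θ, 2)` FALSE for every `θ > 0`).
Calibration, not a kill.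
-/

-- `Summit.ABC.ABC` is the mandated summit-side namespace (CONVENTIONS §2); the duplicate is deliberate.
set_option linter.dupNamespace false

namespace Summit.ABC.ABC.Theorems.TowerFourSubLiouville.Negative

open Polynomial Finset

/-! ## Splitting `S_z ∖ {e}` by residues mod `4` -/

/-- `S_z ∖ {4i+1}` = (odd nodes without `4i+1`) ∪ (even nodes). -/
theorem padeNodes_erase_odd (z i : ℕ) :
    ((range (z + 1)).image (fun i => 4 * i + 1) ∪ (range (z + 1)).image (fun i => 4 * i)).erase (4 * i + 1)
      = ((range (z + 1)).erase i).image (fun i => 4 * i + 1) ∪ (range (z + 1)).image (fun i => 4 * i) := by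
  have hnot : 4 * i + 1 ∉ (range (z + 1)).image (fun i => 4 * i) := by
    simp only [mem_image, mem_range, not_exists, not_and]
    intro j _ h; omega
  rw [erase_union_distrib, image_erase (fun a b h => by simpa using h), erase_eq_of_notMem hnot]

/-- `S_z ∖ {4i}` = (odd nodes) ∪ (even nodes without `4i`). -/
theorem padeNodes_erase_even (z i : ℕ) :
    ((range (z + 1)).image (fun i => 4 * i + 1) ∪ (range (z + 1)).image (fun i => 4 * i)).erase (4 * i)
      = (range (z + 1)).image (fun i => 4 * i + 1) ∪ ((range (z + 1)).erase i).image (fun i => 4 * i) := by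
  have hnot : 4 * i ∉ (range (z + 1)).image (fun i => 4 * i + 1) := by
    simp only [mem_image, mem_range, not_exists, not_and]
    intro j _ h; omega
  rw [erase_union_distrib, image_erase (f := fun i => 4 * i) (fun a b h => by simpa using h), erase_eq_of_notMem hnot]

/-- Odd and even nodes are disjoint. -/
theorem padeNodes_disjoint (s t : Finset ℕ) :
    Disjoint (s.image (fun i => 4 * i + 1)) (t.image (fun i => 4 * i)) := by
  rw [Finset.disjoint_left]
  intro e h1 h2
  simp only [mem_image] at h1 h2
  obtain ⟨i, -, rfl⟩ := h1
  obtain ⟨j, -, hj⟩ := h2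
  omega

/-! ## Signs of the weights -/

/-- **The odd weights are positive**: `∏_{e' ∈ S_z ∖ {4i+1}} ((4i+1) − e') > 0` (`i ≤ z`). -/
theorem padeWeightDen_odd_pos (z i : ℕ) (hi : i ≤ z) :
    0 < ∏ e' ∈ ((range (z + 1)).image (fun i => 4 * i + 1) ∪ (range (z + 1)).image (fun i => 4 * i)).erase (4 * i + 1),
      (((4 * i + 1 : ℕ) : ℚ) - ((e' : ℕ) : ℚ)) := by
  have hiR : i ∈ range (z + 1) := mem_range.mpr (by omega)
  rw [padeNodes_erase_odd z i, prod_union (padeNodes_disjoint _ _),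
    prod_image (fun a _ b _ h => by simpa using h), prod_image (fun a _ b _ h => by simpa using h),
    ← prod_erase_mul (range (z + 1)) _ hiR, ← mul_assoc, ← prod_mul_distrib]
  push_cast
  refine mul_pos (prod_pos (fun i' hi' => ?_)) (by norm_num)
  have hne : i' ≠ i := ne_of_mem_erase hi'
  rcases lt_or_gt_of_ne hne with hlt | hgt
  · have h0 : (i' : ℚ) + 1 ≤ i := by exact_mod_cast hlt
    have h1 : (0 : ℚ) < 4 * ((i : ℚ) - i') := by linarith
    have h2 : (0 : ℚ) < 4 * ((i : ℚ) - i') + 1 := by linarith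
    nlinarith [mul_pos h1 h2]
  · have h0 : (i : ℚ) + 1 ≤ i' := by exact_mod_cast hgt
    have h1 : (0 : ℚ) < 4 * ((i' : ℚ) - i) := by linarith
    have h2 : (0 : ℚ) < 4 * ((i' : ℚ) - i) - 1 := by linarith
    nlinarith [mul_pos h1 h2]

/-- **The even weights are negative**: `∏_{e' ∈ S_z ∖ {4i}} (4i − e') < 0` (`i ≤ z`). -/
theorem padeWeightDen_even_neg (z i : ℕ) (hi : i ≤ z) :
    ∏ e' ∈ ((range (z + 1)).image (fun i => 4 * i + 1) ∪ (range (z + 1)).image (fun i => 4 * i)).erase (4 * i),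
      (((4 * i : ℕ) : ℚ) - ((e' : ℕ) : ℚ)) < 0 := by
  have hiR : i ∈ range (z + 1) := mem_range.mpr (by omega)
  rw [padeNodes_erase_even z i, prod_union (padeNodes_disjoint _ _),
    prod_image (fun a _ b _ h => by simpa using h), prod_image (fun a _ b _ h => by simpa using h),
    ← prod_erase_mul (range (z + 1)) _ hiR, mul_assoc, mul_comm (((4 * i : ℕ) : ℚ) - ((4 * i + 1 : ℕ) : ℚ)),
    ← mul_assoc, ← prod_mul_distrib]
  push_cast
  have hneg : ((4 * (i : ℚ)) - (4 * i + 1)) = -1 := by ring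
  rw [hneg, mul_neg_one, neg_lt_zero]
  refine prod_pos (fun i' hi' => ?_)
  have hne : i' ≠ i := ne_of_mem_erase hi'
  rcases lt_or_gt_of_ne hne with hlt | hgt
  · have h0 : (i' : ℚ) + 1 ≤ i := by exact_mod_cast hlt
    have h1 : (0 : ℚ) < 4 * ((i : ℚ) - i') := by linarith
    have h2 : (0 : ℚ) < 4 * ((i : ℚ) - i') - 1 := by linarith
    nlinarith [mul_pos h1 h2]
  · have h0 : (i : ℚ) + 1 ≤ i' := by exact_mod_cast hgt
    have h1 : (0 : ℚ) < 4 * ((i' : ℚ) - i) := by linarith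
    have h2 : (0 : ℚ) < 4 * ((i' : ℚ) - i) + 1 := by linarith
    nlinarith [mul_pos h1 h2]

/-! ## Integrality: one scalar clears every weight -/

/-- **`M_z·c_e ∈ ℤ`** for `M_z = |∏_{e ∈ S_z} ∏_{e' ≠ e} (e − e')|` and every node `e` (`Λ·c_{e₀} = ∏_{e ≠ e₀} ∏_{e' ≠ e}(e − e')`). -/
theorem padeWeight_integral (z e₀ : ℕ)
    (he₀ : e₀ ∈ (range (z + 1)).image (fun i => 4 * i + 1) ∪ (range (z + 1)).image (fun i => 4 * i)) :
    ∃ m : ℤ, (((∏ e ∈ (range (z + 1)).image (fun i => 4 * i + 1) ∪ (range (z + 1)).image (fun i => 4 * i),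
        ∏ e' ∈ ((range (z + 1)).image (fun i => 4 * i + 1) ∪ (range (z + 1)).image (fun i => 4 * i)).erase e,
          (((e : ℕ) : ℤ) - ((e' : ℕ) : ℤ))).natAbs : ℕ) : ℚ)
      * (∏ e' ∈ ((range (z + 1)).image (fun i => 4 * i + 1) ∪ (range (z + 1)).image (fun i => 4 * i)).erase e₀,
          (((e₀ : ℕ) : ℚ) - ((e' : ℕ) : ℚ)))⁻¹ = m := by
  set S := (range (z + 1)).image (fun i => 4 * i + 1) ∪ (range (z + 1)).image (fun i => 4 * i) with hS
  set Λ : ℤ := ∏ e ∈ S, ∏ e' ∈ S.erase e, (((e : ℕ) : ℤ) - ((e' : ℕ) : ℤ)) with hΛ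
  set D : ℚ := ∏ e' ∈ S.erase e₀, (((e₀ : ℕ) : ℚ) - ((e' : ℕ) : ℚ)) with hD
  have hD0 : D ≠ 0 := fun h0 => padeWeight_ne_zero z e₀ (by rw [← hD, h0, inv_zero])
  set m₀ : ℤ := ∏ e ∈ S.erase e₀, ∏ e' ∈ S.erase e, (((e : ℕ) : ℤ) - ((e' : ℕ) : ℤ)) with hm₀
  have hΛq : (Λ : ℚ) = (m₀ : ℚ) * D := by
    rw [hΛ, hm₀, hD, ← prod_erase_mul S _ he₀]
    push_cast
    rfl
  have hkey : (Λ : ℚ) * D⁻¹ = m₀ := by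
    rw [hΛq, mul_assoc, mul_inv_cancel₀ hD0, mul_one]
  rcases le_or_gt 0 Λ with hpos | hneg
  · refine ⟨m₀, ?_⟩
    rw [Nat.cast_natAbs, Int.cast_abs, abs_of_nonneg (by exact_mod_cast hpos), hkey]
  · refine ⟨-m₀, ?_⟩
    rw [Nat.cast_natAbs, Int.cast_abs, abs_of_neg (by exact_mod_cast hneg), neg_mul, hkey, Int.cast_neg]

/-- The scalar `M_z` is positive. -/
theorem padeWeightScalar_pos (z : ℕ) :
    0 < (∏ e ∈ (range (z + 1)).image (fun i => 4 * i + 1) ∪ (range (z + 1)).image (fun i => 4 * i),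
        ∏ e' ∈ ((range (z + 1)).image (fun i => 4 * i + 1) ∪ (range (z + 1)).image (fun i => 4 * i)).erase e,
          (((e : ℕ) : ℤ) - ((e' : ℕ) : ℤ))).natAbs := by
  refine Int.natAbs_pos.mpr (prod_ne_zero_iff.mpr (fun e _ => prod_ne_zero_iff.mpr (fun e' he' => ?_)))
  have hne : e' ≠ e := ne_of_mem_erase he'
  have : (e : ℤ) ≠ (e' : ℤ) := by exact_mod_cast hne.symm
  exact sub_ne_zero.mpr this

/-! ## The value bound of a homogenised Padé pair -/

/-- A polynomial is bounded on `[1, 2]` by `Σ |coeff_j|·2^j`. -/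
theorem abs_eval_le_of_mem_Icc (K : ℚ[X]) (x : ℚ) (hx1 : 1 ≤ x) (hx2 : x ≤ 2) :
    |K.eval x| ≤ ∑ j ∈ range (K.natDegree + 1), |K.coeff j| * 2 ^ j := by
  rw [eval_eq_sum_range]
  refine (abs_sum_le_sum_abs _ _).trans (sum_le_sum (fun j _ => ?_))
  rw [abs_mul, abs_pow, abs_of_nonneg (by linarith : (0:ℚ) ≤ x)]
  exact mul_le_mul_of_nonneg_left (pow_le_pow_left₀ (by linarith) hx2 j) (abs_nonneg _)

/-- **From the Padé divisibility to the value bound**: if `(X − 1)^{2z+1} ∣ X·p⁴ − q⁴` for `p = Σ_{i≤z} aᵢXⁱ`, `q = Σ_{i≤z} bᵢXⁱ`, then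
`P(N) = Σ aᵢ(N+1)ⁱN^{z−i}`, `Q(N) = Σ bᵢ(N+1)ⁱN^{z−i}` satisfy `|(N+1)·P(N)⁴ − N·Q(N)⁴| ≤ C·N^{2z}` for all `N ≥ 1`
(`(N+1)P⁴ − NQ⁴ = N^{4z+1}·[xp(x)⁴ − q(x)⁴]_{x = (N+1)/N} = N^{2z}·K(x)`). -/
theorem padeValue_bound (z : ℕ) (a b : ℕ → ℚ)
    (h : (X - C 1) ^ (2 * z + 1) ∣
      X * (∑ i ∈ range (z + 1), C (a i) * X ^ i) ^ 4 - (∑ i ∈ range (z + 1), C (b i) * X ^ i) ^ 4) :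
    ∃ C₀ : ℚ, 0 ≤ C₀ ∧ ∀ N : ℕ, 1 ≤ N →
      |((N : ℚ) + 1) * (∑ i ∈ range (z + 1), a i * ((N : ℚ) + 1) ^ i * (N : ℚ) ^ (z - i)) ^ 4
          - (N : ℚ) * (∑ i ∈ range (z + 1), b i * ((N : ℚ) + 1) ^ i * (N : ℚ) ^ (z - i)) ^ 4|
        ≤ C₀ * (N : ℚ) ^ (2 * z) := by
  obtain ⟨K, hK⟩ := h
  refine ⟨∑ j ∈ range (K.natDegree + 1), |K.coeff j| * 2 ^ j, sum_nonneg (fun j _ => by positivity), ?_⟩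
  intro N hN
  have hN0 : (0 : ℚ) < N := by exact_mod_cast hN
  set x : ℚ := ((N : ℚ) + 1) / N with hx
  have hx1 : 1 ≤ x := by rw [hx, le_div_iff₀ hN0]; linarith
  have hx2 : x ≤ 2 := by
    rw [hx, div_le_iff₀ hN0]
    have : (1 : ℚ) ≤ N := by exact_mod_cast hN
    linarith
  have hxm : x - 1 = 1 / N := by rw [hx]; field_simp; ring
  have hev := congrArg (Polynomial.eval x) hK
  simp only [eval_sub, eval_mul, eval_X, eval_pow, eval_finsetSum, eval_C] at hev
  have hhom : ∀ c : ℕ → ℚ, (N : ℚ) ^ z * ∑ i ∈ range (z + 1), c i * x ^ i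
      = ∑ i ∈ range (z + 1), c i * ((N : ℚ) + 1) ^ i * (N : ℚ) ^ (z - i) := by
    intro c
    rw [Finset.mul_sum]
    refine sum_congr rfl (fun i hi => ?_)
    have hiz : i ≤ z := Nat.lt_succ_iff.mp (mem_range.mp hi)
    obtain ⟨k, rfl⟩ := Nat.exists_eq_add_of_le hiz
    rw [hx, div_pow, pow_add, Nat.add_sub_cancel_left]
    field_simp
  have hP := hhom a
  have hQ := hhom b
  have key : ((N : ℚ) + 1) * (∑ i ∈ range (z + 1), a i * ((N : ℚ) + 1) ^ i * (N : ℚ) ^ (z - i)) ^ 4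
      - (N : ℚ) * (∑ i ∈ range (z + 1), b i * ((N : ℚ) + 1) ^ i * (N : ℚ) ^ (z - i)) ^ 4
      = (N : ℚ) ^ (2 * z) * K.eval x := by
    rw [← hP, ← hQ]
    have hx' : ((N : ℚ) + 1) = N * x := by rw [hx]; field_simp
    have e1 : (N : ℚ) * x * ((N : ℚ) ^ z * ∑ i ∈ range (z + 1), a i * x ^ i) ^ 4
        - (N : ℚ) * ((N : ℚ) ^ z * ∑ i ∈ range (z + 1), b i * x ^ i) ^ 4
        = (N : ℚ) ^ (4 * z + 1) * (x * (∑ i ∈ range (z + 1), a i * x ^ i) ^ 4 - (∑ i ∈ range (z + 1), b i * x ^ i) ^ 4) := by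
      ring
    have hN0' : (N : ℚ) ≠ 0 := hN0.ne'
    rw [hx', e1, hev, hxm, one_div, inv_pow]
    have hsplit : (N : ℚ) ^ (4 * z + 1) = (N : ℚ) ^ (2 * z) * (N : ℚ) ^ (2 * z + 1) := by
      rw [← pow_add]; congr 1; ring
    rw [hsplit, mul_assoc, ← mul_assoc ((N : ℚ) ^ (2 * z + 1)), mul_inv_cancel₀ (pow_ne_zero _ hN0'), one_mul]
  rw [key, abs_mul, abs_of_nonneg (by positivity), mul_comm]
  exact mul_le_mul_of_nonneg_right (abs_eval_le_of_mem_Icc K x hx1 hx2) (by positivity)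

/-! ## The step data of order `z`, packaged -/

/-- **Padé step data of every order**: for every `z` there are integers `a₀, …, a_z > 0`, `b₀, …, b_z > 0` and a constant `C` such that the
homogenised step values `P(N) = Σ aᵢ(N+1)ⁱN^{z−i}`, `Q(N) = Σ bᵢ(N+1)ⁱN^{z−i}` satisfy `|(N+1)·P(N)⁴ − N·Q(N)⁴| ≤ C·N^{2z}` for all `N ≥ 1`
(`aᵢ = M_z·c_{4i+1}`, `bᵢ = −M_z·c_{4i}`: the `[z/z]` Padé pair of `⁴√(1 + 1/N)`, cleared of denominators). -/
theorem exists_padeStepData (z : ℕ) :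
    ∃ (a b : ℕ → ℤ) (C₀ : ℕ), (∀ i, i ≤ z → 0 < a i ∧ 0 < b i) ∧
      ∀ N : ℕ, 1 ≤ N →
        |((N : ℤ) + 1) * (∑ i ∈ range (z + 1), a i * ((N : ℤ) + 1) ^ i * (N : ℤ) ^ (z - i)) ^ 4
            - (N : ℤ) * (∑ i ∈ range (z + 1), b i * ((N : ℤ) + 1) ^ i * (N : ℤ) ^ (z - i)) ^ 4|
          ≤ C₀ * (N : ℤ) ^ (2 * z) := by
  set S := (range (z + 1)).image (fun i => 4 * i + 1) ∪ (range (z + 1)).image (fun i => 4 * i) with hS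
  set c : ℕ → ℚ := fun e => (∏ e' ∈ S.erase e, (((e : ℕ) : ℚ) - ((e' : ℕ) : ℚ)))⁻¹ with hc
  set M : ℕ := (∏ e ∈ S, ∏ e' ∈ S.erase e, (((e : ℕ) : ℤ) - ((e' : ℕ) : ℤ))).natAbs with hM
  have hMpos : 0 < M := padeWeightScalar_pos z
  have hMq : (0 : ℚ) < M := by exact_mod_cast hMpos
  -- integral weights
  have hint : ∀ e ∈ S, ∃ m : ℤ, (M : ℚ) * c e = m := fun e he => padeWeight_integral z e he
  have hmem_odd : ∀ i, i ≤ z → 4 * i + 1 ∈ S := fun i hi =>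
    mem_union_left _ (mem_image.mpr ⟨i, mem_range.mpr (by omega), rfl⟩)
  have hmem_even : ∀ i, i ≤ z → 4 * i ∈ S := fun i hi =>
    mem_union_right _ (mem_image.mpr ⟨i, mem_range.mpr (by omega), rfl⟩)
  set a : ℕ → ℤ := fun i => ((M : ℚ) * c (4 * i + 1)).num with ha
  set b : ℕ → ℤ := fun i => -((M : ℚ) * c (4 * i)).num with hb
  have haq : ∀ i, i ≤ z → (a i : ℚ) = (M : ℚ) * c (4 * i + 1) := by
    intro i hi
    obtain ⟨m, hm⟩ := hint _ (hmem_odd i hi)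
    rw [ha]; dsimp only; rw [hm, Rat.num_intCast]
  have hbq : ∀ i, i ≤ z → (b i : ℚ) = (M : ℚ) * (-c (4 * i)) := by
    intro i hi
    obtain ⟨m, hm⟩ := hint _ (hmem_even i hi)
    rw [hb]; dsimp only; rw [hm, Rat.num_intCast, Int.cast_neg, ← hm]; ring
  -- signs
  have hsign : ∀ i, i ≤ z → 0 < a i ∧ 0 < b i := by
    intro i hi
    have h1 : 0 < c (4 * i + 1) := by
      rw [hc]; dsimp only
      exact inv_pos.mpr (by exact_mod_cast padeWeightDen_odd_pos z i hi)
    have h2 : c (4 * i) < 0 := by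
      rw [hc]; dsimp only
      exact inv_lt_zero.mpr (by exact_mod_cast padeWeightDen_even_neg z i hi)
    constructor
    · have : (0 : ℚ) < a i := by rw [haq i hi]; exact mul_pos hMq h1
      exact_mod_cast this
    · have : (0 : ℚ) < b i := by rw [hbq i hi]; exact mul_pos hMq (by linarith)
      exact_mod_cast this
  -- the divisibility for the scaled (integral) pair
  have hdvd : (X - C 1) ^ (2 * z + 1) ∣
      X * (∑ i ∈ range (z + 1), C ((a i : ℚ)) * X ^ i) ^ 4 - (∑ i ∈ range (z + 1), C ((b i : ℚ)) * X ^ i) ^ 4 := by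
    have h0 := padeQuartic_dvd z
    have hp : ∑ i ∈ range (z + 1), C ((a i : ℚ)) * X ^ i
        = C (M : ℚ) * ∑ i ∈ range (z + 1), C (c (4 * i + 1)) * X ^ i := by
      rw [Finset.mul_sum]
      refine sum_congr rfl (fun i hi => ?_)
      rw [haq i (Nat.lt_succ_iff.mp (mem_range.mp hi)), map_mul]; ring
    have hq : ∑ i ∈ range (z + 1), C ((b i : ℚ)) * X ^ i
        = C (M : ℚ) * ∑ i ∈ range (z + 1), C (-c (4 * i)) * X ^ i := by
      rw [Finset.mul_sum]
      refine sum_congr rfl (fun i hi => ?_)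
      rw [hbq i (Nat.lt_succ_iff.mp (mem_range.mp hi)), map_mul]; ring
    rw [hp, hq]
    have e : X * (C (M : ℚ) * ∑ i ∈ range (z + 1), C (c (4 * i + 1)) * X ^ i) ^ 4
        - (C (M : ℚ) * ∑ i ∈ range (z + 1), C (-c (4 * i)) * X ^ i) ^ 4
        = (C (M : ℚ)) ^ 4 * (X * (∑ i ∈ range (z + 1), C (c (4 * i + 1)) * X ^ i) ^ 4
          - (∑ i ∈ range (z + 1), C (-c (4 * i)) * X ^ i) ^ 4) := by ring
    rw [e]
    exact Dvd.dvd.mul_left h0 _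
  obtain ⟨C₀, hC₀, hbound⟩ := padeValue_bound z (fun i => (a i : ℚ)) (fun i => (b i : ℚ)) hdvd
  refine ⟨a, b, ⌈C₀⌉₊, hsign, ?_⟩
  intro N hN
  have hb' := hbound N hN
  have hceil : C₀ ≤ (⌈C₀⌉₊ : ℚ) := Nat.le_ceil C₀
  have hNq : (0 : ℚ) ≤ (N : ℚ) ^ (2 * z) := by positivity
  have hfin : |((N : ℚ) + 1) * (∑ i ∈ range (z + 1), (a i : ℚ) * ((N : ℚ) + 1) ^ i * (N : ℚ) ^ (z - i)) ^ 4
      - (N : ℚ) * (∑ i ∈ range (z + 1), (b i : ℚ) * ((N : ℚ) + 1) ^ i * (N : ℚ) ^ (z - i)) ^ 4|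
      ≤ (⌈C₀⌉₊ : ℚ) * (N : ℚ) ^ (2 * z) := hb'.trans (mul_le_mul_of_nonneg_right hceil hNq)
  have hcast : ((|((N : ℤ) + 1) * (∑ i ∈ range (z + 1), a i * ((N : ℤ) + 1) ^ i * (N : ℤ) ^ (z - i)) ^ 4
      - (N : ℤ) * (∑ i ∈ range (z + 1), b i * ((N : ℤ) + 1) ^ i * (N : ℤ) ^ (z - i)) ^ 4| : ℤ) : ℚ)
      ≤ (((⌈C₀⌉₊ * (N : ℤ) ^ (2 * z) : ℤ)) : ℚ) := by
    push_cast
    exact hfin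
  exact_mod_cast hcast


end Summit.ABC.ABC.Theorems.TowerFourSubLiouville.Negative
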